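import Mathlib
import Literature.Analysis.DeBrangesSpaces.HalfPlanePaleyWiener
import HarnessLib

/-!
# Paley–Wiener for `H²(ℂ₊)` — the general form (a.e. boundary values)

Topic `Literature/Analysis/DeBrangesSpaces` (support file: theorems only, no definitions, no named
facts). Let `G` be holomorphic on the open upper half-plane with the Hardy bound
`∫_ℝ ‖G(x + iy)‖² dx ≤ M²` for every `y > 0`. We prove:

* `norm_le_of_hardy` — the pointwise bound `‖G(z)‖ ≤ 2M/√(π Im z)` (mean value property of `G²` on
  discs, polar coordinates and Fubini; Rudin, *Real and complex analysis*, 19.1-type lemma);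
* `exists_halfLine_laplace_of_hardy` — **Paley–Wiener** (Rudin, Thm. 19.2): there is
  `ψ ∈ L²(ℝ)` vanishing a.e. on `(−∞, 0)` with `G(w) = ∫₀^∞ ψ(x) e^{iwx} dx` for EVERY `w` in the
  open upper half-plane, and `2π ∫‖ψ‖² ≤ M²`.

The second item is obtained from the boundary-regular case (`HalfPlanePaleyWiener.lean`) applied to
the vertical translates `G(· + iε)`, which satisfy its decay hypothesis by the first item; the
representing functions `ψ_ε = e^{−εx}ψ` are identified by Fourier uniqueness and `ψ ∈ L²` follows
by monotone convergence. All statements are folklore.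
-/

noncomputable section

namespace Literature.Analysis.DeBrangesSpaces

open _root_.MeasureTheory _root_.Complex Set Filter Metric FourierTransform
open scoped ComplexConjugate FourierTransform Topology Real ENNReal InnerProductSpace

/-! ## A. The pointwise bound for `H²` functions -/

section Pointwise

variable {G : ℂ → ℂ} {M : ℝ}

/-- **Sub-mean-value for `‖G‖²` on circles**: if `G` is holomorphic on the open upper half-plane
and `0 < r < Im c`, then `2π‖G(c)‖² ≤ ∫_{−π}^{π} ‖G(c + re^{iθ})‖² dθ` (mean value property of the
holomorphic function `G²`). [cite: Rudin1987, Thm. 19.2 (proof, §19.1)] -/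
theorem two_pi_mul_norm_sq_le_integral_circle (hd : DifferentiableOn ℂ G {z : ℂ | 0 < z.im})
    {c : ℂ} {r : ℝ} (hr : 0 < r) (hrc : r < c.im) :
    2 * π * ‖G c‖ ^ 2 ≤ ∫ θ in (-π)..π, ‖G (circleMap c r θ)‖ ^ 2 := by
  -- the closed disc lies in the upper half-plane
  have hsub : closedBall c r ⊆ {z : ℂ | 0 < z.im} := by
    intro z hz
    rw [mem_closedBall, dist_eq_norm] at hz
    have := abs_im_le_norm (z - c)
    rw [sub_im] at this
    show 0 < z.im
    have h' : |z.im - c.im| ≤ r := this.trans hz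
    linarith [abs_le.1 h' |>.1]
  have hG2 : DiffContOnCl ℂ (fun z ↦ G z ^ 2) (ball c |r|) := by
    rw [abs_of_pos hr]
    exact (hd.pow 2).diffContOnCl_ball hsub
  have hmv : Real.circleAverage (fun z ↦ G z ^ 2) c r = G c ^ 2 := hG2.circleAverage
  -- `‖G c‖² = ‖circleAverage (G²)‖ ≤ (2π)⁻¹ ∫₀^{2π} ‖G‖²`
  have h1 : ‖G c‖ ^ 2 ≤ (2 * π)⁻¹ * ∫ θ in (0 : ℝ)..2 * π, ‖G (circleMap c r θ)‖ ^ 2 := by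
    rw [← norm_pow, ← hmv, Real.circleAverage_def, norm_smul, Real.norm_of_nonneg (by positivity)]
    refine mul_le_mul_of_nonneg_left ?_ (by positivity)
    refine (intervalIntegral.norm_integral_le_integral_norm (by positivity)).trans_eq ?_
    congr 1 with θ
    rw [norm_pow]
  -- shift the period interval `[0, 2π]` to `[−π, π]`
  have hper : Function.Periodic (fun θ : ℝ ↦ ‖G (circleMap c r θ)‖ ^ 2) (2 * π) := fun θ ↦ by
    simp only [periodic_circleMap c r θ]
  have h2 : ∫ θ in (0 : ℝ)..2 * π, ‖G (circleMap c r θ)‖ ^ 2 =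
      ∫ θ in (-π)..π, ‖G (circleMap c r θ)‖ ^ 2 := by
    have := hper.intervalIntegral_add_eq 0 (-π)
    rw [zero_add, show -π + 2 * π = π by ring] at this
    exact this
  rw [h2] at h1
  have h2π : 0 < 2 * π := Real.two_pi_pos
  calc 2 * π * ‖G c‖ ^ 2 ≤ 2 * π * ((2 * π)⁻¹ * ∫ θ in (-π)..π, ‖G (circleMap c r θ)‖ ^ 2) :=
        mul_le_mul_of_nonneg_left h1 h2π.le
    _ = ∫ θ in (-π)..π, ‖G (circleMap c r θ)‖ ^ 2 := by field_simp

/-- The measurable modification `G₀ = 1_{ℂ₊} G` (equal to `G` on the open upper half-plane).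
[cite: Rudin1987, Thm. 19.2 (proof)] -/
private theorem measurable_indicator_uhp (hd : DifferentiableOn ℂ G {z : ℂ | 0 < z.im}) :
    Measurable ({z : ℂ | 0 < z.im}.indicator G) := by
  classical
  have hopen : IsOpen {z : ℂ | 0 < z.im} := isOpen_lt continuous_const Complex.continuous_im
  rw [← Set.piecewise_eq_indicator]
  exact hd.continuousOn.measurable_piecewise continuousOn_const hopen.measurableSet

/-- Points of the circle `|z − c| = r`, `0 ≤ r < Im c`, lie in the open upper half-plane. [folklore] -/
private theorem circleMap_im_pos {c : ℂ} {r : ℝ} (hr : 0 ≤ r) (hrc : r < c.im) (θ : ℝ) :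
    0 < (circleMap c r θ).im := by
  have h1 : ‖circleMap c r θ - c‖ = r := by
    rw [circleMap_sub_center, norm_circleMap_zero, abs_of_nonneg hr]
  have h2 := abs_im_le_norm (circleMap c r θ - c)
  rw [h1, sub_im] at h2
  linarith [(abs_le.1 h2).1]

/-- **Area sub-mean-value**: for `0 < R < Im c`, `πR²‖G(c)‖² ≤ ∫∫_{|z|<R} ‖G(c + z)‖² dA(z)`
(circles of radius `r < R`, polar coordinates). [cite: Rudin1987, Thm. 19.2 (proof, §19.1)] -/
theorem pi_mul_sq_mul_norm_sq_le_lintegral_ball (hd : DifferentiableOn ℂ G {z : ℂ | 0 < z.im})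
    {c : ℂ} {R : ℝ} (hR : 0 < R) (hRc : R < c.im) :
    ENNReal.ofReal (π * R ^ 2 * ‖G c‖ ^ 2) ≤
      ∫⁻ z in ball (0 : ℂ) R, ENNReal.ofReal (‖({z : ℂ | 0 < z.im}.indicator G) (c + z)‖ ^ 2) := by
  classical
  set G₀ : ℂ → ℂ := {z : ℂ | 0 < z.im}.indicator G with hG₀
  have hG₀m : Measurable G₀ := measurable_indicator_uhp hd
  have hG₀eq : ∀ z : ℂ, 0 < z.im → G₀ z = G z := fun z hz ↦ by
    rw [hG₀, indicator_of_mem (show z ∈ {z : ℂ | 0 < z.im} from hz)]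
  -- the integrand and its polar form
  set h : ℂ → ℝ≥0∞ := fun z ↦ ENNReal.ofReal (‖G₀ (c + z)‖ ^ 2) with hh
  have hhm : Measurable h := by
    refine ENNReal.measurable_ofReal.comp ?_
    exact ((hG₀m.comp (measurable_const.add measurable_id)).norm).pow_const 2
  -- polar coordinates
  have hpolar := Complex.lintegral_comp_polarCoord_symm ((ball (0 : ℂ) R).indicator h)
  rw [lintegral_indicator measurableSet_ball] at hpolar
  rw [← hpolar]
  -- on the target, the indicator is `1_{r < R}`
  have hsymm_mem : ∀ p : ℝ × ℝ, p ∈ polarCoord.target →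
      (Complex.polarCoord.symm p ∈ ball (0 : ℂ) R ↔ p.1 < R) := by
    intro p hp
    rw [mem_ball_zero_iff, Complex.norm_polarCoord_symm, abs_of_pos (show 0 < p.1 from hp.1)]
  have hcircle : ∀ p : ℝ × ℝ, c + Complex.polarCoord.symm p = circleMap c p.1 p.2 := by
    intro p
    rw [Complex.polarCoord_symm_apply, circleMap, Complex.exp_mul_I]
    push_cast
    ring
  -- restrict to the box `(0,R) × (−π,π)`
  have hbox : Ioo (0 : ℝ) R ×ˢ Ioo (-π) π ⊆ polarCoord.target := by
    rw [polarCoord_target]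
    exact prod_mono Ioo_subset_Ioi_self le_rfl
  set F : ℝ × ℝ → ℝ≥0∞ := fun p ↦
    ENNReal.ofReal p.1 * ENNReal.ofReal (‖G₀ (circleMap c p.1 p.2)‖ ^ 2) with hF
  have hFm : Measurable F := by
    refine (ENNReal.measurable_ofReal.comp measurable_fst).mul
      (ENNReal.measurable_ofReal.comp ?_)
    have hcm : Measurable fun p : ℝ × ℝ ↦ circleMap c p.1 p.2 := by
      have : Continuous fun p : ℝ × ℝ ↦ circleMap c p.1 p.2 := by
        unfold circleMap; fun_prop
      exact this.measurable
    exact ((hG₀m.comp hcm).norm).pow_const 2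
  have hle1 : ∫⁻ p in Ioo (0 : ℝ) R ×ˢ Ioo (-π) π, F p ≤
      ∫⁻ p in polarCoord.target,
        ENNReal.ofReal p.1 • (ball (0 : ℂ) R).indicator h (Complex.polarCoord.symm p) := by
    calc ∫⁻ p in Ioo (0 : ℝ) R ×ˢ Ioo (-π) π, F p
        = ∫⁻ p in Ioo (0 : ℝ) R ×ˢ Ioo (-π) π,
            ENNReal.ofReal p.1 • (ball (0 : ℂ) R).indicator h (Complex.polarCoord.symm p) := by
          refine setLIntegral_congr_fun (measurableSet_Ioo.prod measurableSet_Ioo) (fun p hp ↦ ?_)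
          have hp' : p ∈ polarCoord.target := hbox hp
          have hmem : Complex.polarCoord.symm p ∈ ball (0 : ℂ) R := (hsymm_mem p hp').2 hp.1.2
          rw [indicator_of_mem hmem, hh, smul_eq_mul, hF]
          simp only
          rw [hcircle]
      _ ≤ _ := lintegral_mono_set hbox
  refine le_trans ?_ hle1
  -- Tonelli on the box and the circle inequality
  rw [Measure.volume_eq_prod, ← Measure.prod_restrict, lintegral_prod _ hFm.aemeasurable]
  have hinner : ∀ r ∈ Ioo (0 : ℝ) R,
      ENNReal.ofReal r * ENNReal.ofReal (2 * π * ‖G c‖ ^ 2) ≤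
        ∫⁻ θ in Ioo (-π) π, F (r, θ) := by
    intro r hr
    have hrc : r < c.im := hr.2.trans hRc
    -- continuity of the integrand on the circle
    have hsub : ∀ θ : ℝ, circleMap c r θ ∈ {z : ℂ | 0 < z.im} := fun θ ↦
      circleMap_im_pos hr.1.le hrc θ
    have hcont : Continuous fun θ : ℝ ↦ ‖G (circleMap c r θ)‖ ^ 2 :=
      ((hd.continuousOn.comp_continuous (continuous_circleMap c r) hsub).norm).pow 2
    have heqF : ∀ θ : ℝ, F (r, θ) = ENNReal.ofReal r * ENNReal.ofReal (‖G (circleMap c r θ)‖ ^ 2) := by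
      intro θ
      rw [hF]
      simp only
      rw [hG₀eq _ (hsub θ)]
    simp_rw [heqF]
    rw [lintegral_const_mul' _ _ ENNReal.ofReal_ne_top]
    gcongr
    -- `ofReal (2π‖G c‖²) ≤ ∫⁻ ofReal ‖G‖²` from the real inequality
    have hint : IntegrableOn (fun θ : ℝ ↦ ‖G (circleMap c r θ)‖ ^ 2) (Ioo (-π) π) :=
      (hcont.integrableOn_Icc).mono_set Ioo_subset_Icc_self
    rw [← ofReal_integral_eq_lintegral_ofReal hint (ae_of_all _ fun θ ↦ by positivity)]
    refine ENNReal.ofReal_le_ofReal ?_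
    have h := two_pi_mul_norm_sq_le_integral_circle hd hr.1 hrc
    rwa [intervalIntegral.integral_of_le (by linarith [Real.pi_pos]),
      integral_Ioc_eq_integral_Ioo] at h
  have hI : ∫⁻ r in Ioo (0 : ℝ) R, ENNReal.ofReal r = ENNReal.ofReal (R ^ 2 / 2) := by
    have hint : IntegrableOn (fun r : ℝ ↦ r) (Ioo 0 R) :=
      (continuous_id.integrableOn_Icc).mono_set Ioo_subset_Icc_self
    rw [← ofReal_integral_eq_lintegral_ofReal hint (by
      filter_upwards [ae_restrict_mem measurableSet_Ioo] with r hr using hr.1.le)]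
    congr 1
    rw [← integral_Ioc_eq_integral_Ioo, ← intervalIntegral.integral_of_le hR.le, integral_id]
    ring
  calc ENNReal.ofReal (π * R ^ 2 * ‖G c‖ ^ 2)
      = (∫⁻ r in Ioo (0 : ℝ) R, ENNReal.ofReal r) * ENNReal.ofReal (2 * π * ‖G c‖ ^ 2) := by
        rw [hI, ← ENNReal.ofReal_mul (by positivity)]
        congr 1
        ring
    _ = ∫⁻ r in Ioo (0 : ℝ) R, ENNReal.ofReal r * ENNReal.ofReal (2 * π * ‖G c‖ ^ 2) := by
        rw [lintegral_mul_const _ ENNReal.measurable_ofReal]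
    _ ≤ ∫⁻ r in Ioo (0 : ℝ) R, ∫⁻ θ in Ioo (-π) π, F (r, θ) :=
        setLIntegral_mono' measurableSet_Ioo fun r hr ↦ hinner r hr

/-- **The strip bound**: for `0 < R < Im c`, `∫∫_{|z|<R} ‖G(c + z)‖² dA ≤ 2R·M²` — the disc lies
in the strip `|Im z| < R`, on whose horizontal lines the `L²` norms are `≤ M²` (Fubini).
[cite: Rudin1987, Thm. 19.2 (proof, §19.1)] -/
theorem lintegral_ball_le_of_hardy (hd : DifferentiableOn ℂ G {z : ℂ | 0 < z.im})
    (h2 : ∀ y : ℝ, 0 < y → Integrable (fun x : ℝ ↦ ‖G (x + y * I)‖ ^ 2))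
    (hM : ∀ y : ℝ, 0 < y → ∫ x : ℝ, ‖G (x + y * I)‖ ^ 2 ≤ M ^ 2)
    {c : ℂ} {R : ℝ} (hRc : R < c.im) :
    ∫⁻ z in ball (0 : ℂ) R, ENNReal.ofReal (‖({z : ℂ | 0 < z.im}.indicator G) (c + z)‖ ^ 2) ≤
      ENNReal.ofReal (2 * R * M ^ 2) := by
  classical
  rcases le_or_gt R 0 with hR0 | hR0
  · rw [Metric.ball_eq_empty.2 hR0, Measure.restrict_empty, lintegral_zero_measure]
    exact bot_le
  set G₀ : ℂ → ℂ := {z : ℂ | 0 < z.im}.indicator G with hG₀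
  have hG₀m : Measurable G₀ := measurable_indicator_uhp hd
  have hG₀eq : ∀ z : ℂ, 0 < z.im → G₀ z = G z := fun z hz ↦ by
    rw [hG₀, indicator_of_mem (show z ∈ {z : ℂ | 0 < z.im} from hz)]
  set h : ℂ → ℝ≥0∞ := fun z ↦ ENNReal.ofReal (‖G₀ (c + z)‖ ^ 2) with hh
  have hhm : Measurable h := by
    refine ENNReal.measurable_ofReal.comp ?_
    exact ((hG₀m.comp (measurable_const.add measurable_id)).norm).pow_const 2
  -- the disc lies in the strip `|Im z| < R`
  set S : Set ℂ := {z : ℂ | z.im ∈ Ioo (-R) R} with hS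
  have hSm : MeasurableSet S := measurableSet_Ioo.preimage Complex.measurable_im
  have hballS : ball (0 : ℂ) R ⊆ S := by
    intro z hz
    rw [mem_ball_zero_iff] at hz
    have h := lt_of_le_of_lt (abs_im_le_norm z) hz
    exact ⟨(abs_lt.1 h).1, (abs_lt.1 h).2⟩
  refine (lintegral_mono_set hballS).trans ?_
  rw [← lintegral_indicator hSm]
  -- to `ℝ × ℝ` coordinates
  have hmp := (Complex.volume_preserving_equiv_real_prod.symm)
  rw [← hmp.lintegral_comp_emb Complex.measurableEquivRealProd.symm.measurableEmbedding]
  -- the integrand in coordinates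
  set K : ℝ × ℝ → ℝ≥0∞ := fun q ↦ (Ioo (-R) R).indicator (fun _ ↦ (1 : ℝ≥0∞)) q.2 *
    ENNReal.ofReal (‖G₀ (c + (q.1 + q.2 * I))‖ ^ 2) with hK
  have hKeq : ∀ q : ℝ × ℝ, S.indicator h (Complex.measurableEquivRealProd.symm q) = K q := by
    intro q
    have hz : Complex.measurableEquivRealProd.symm q = (q.1 : ℂ) + q.2 * I := by
      rw [Complex.measurableEquivRealProd_symm_apply]
      apply Complex.ext <;> simp
    rw [hz]
    show S.indicator h _ = (Ioo (-R) R).indicator (fun _ ↦ (1 : ℝ≥0∞)) q.2 *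
      ENNReal.ofReal (‖G₀ (c + ((q.1 : ℂ) + q.2 * I))‖ ^ 2)
    by_cases hq : q.2 ∈ Ioo (-R) R
    · have hmem : ((q.1 : ℂ) + q.2 * I) ∈ S := by
        show ((q.1 : ℂ) + q.2 * I).im ∈ Ioo (-R) R
        simpa using hq
      rw [indicator_of_mem hmem, indicator_of_mem hq, one_mul]
    · have hmem : ((q.1 : ℂ) + q.2 * I) ∉ S := by
        show ¬ (((q.1 : ℂ) + q.2 * I).im ∈ Ioo (-R) R)
        simpa using hq
      rw [indicator_of_notMem hmem, indicator_of_notMem hq, zero_mul]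
  have hKm : Measurable K := by
    refine Measurable.mul ((measurable_const.indicator measurableSet_Ioo).comp measurable_snd)
      (ENNReal.measurable_ofReal.comp ?_)
    have : Measurable fun q : ℝ × ℝ ↦ c + ((q.1 : ℂ) + q.2 * I) :=
      measurable_const.add ((Complex.measurable_ofReal.comp measurable_fst).add
        ((Complex.measurable_ofReal.comp measurable_snd).mul measurable_const))
    exact ((hG₀m.comp this).norm).pow_const 2
  have hcongr : ∫⁻ q : ℝ × ℝ, S.indicator h (Complex.measurableEquivRealProd.symm q) =
      ∫⁻ q : ℝ × ℝ, K q := lintegral_congr fun q ↦ hKeq q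
  refine (le_of_eq hcongr).trans ?_
  rw [Measure.volume_eq_prod, lintegral_prod_symm _ hKm.aemeasurable]
  -- the inner integrals are the `L²` norms on horizontal lines
  have hinner : ∀ b : ℝ, ∫⁻ a : ℝ, K (a, b) ≤
      (Ioo (-R) R).indicator (fun _ ↦ ENNReal.ofReal (M ^ 2)) b := by
    intro b
    by_cases hb : b ∈ Ioo (-R) R
    · rw [indicator_of_mem hb]
      have hyb : 0 < c.im + b := by linarith [hb.1]
      have hKb : ∀ a : ℝ, K (a, b) =
          ENNReal.ofReal (‖G (((a + c.re : ℝ) : ℂ) + (c.im + b : ℝ) * I)‖ ^ 2) := by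
        intro a
        show (Ioo (-R) R).indicator (fun _ ↦ (1 : ℝ≥0∞)) b *
          ENNReal.ofReal (‖G₀ (c + ((a : ℂ) + b * I))‖ ^ 2) = _
        have hpt : c + ((a : ℂ) + b * I) = ((a + c.re : ℝ) : ℂ) + (c.im + b : ℝ) * I := by
          apply Complex.ext
          · simp only [Complex.add_re, Complex.ofReal_re, Complex.mul_re, Complex.I_re,
              Complex.ofReal_im, Complex.I_im, mul_zero, mul_one, sub_zero]
            ring
          · simp only [Complex.add_im, Complex.ofReal_im, Complex.mul_im, Complex.I_re,
              Complex.ofReal_re, Complex.I_im, mul_zero, mul_one, zero_add, add_zero]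
        rw [indicator_of_mem hb, one_mul, hpt, hG₀eq _ (by simpa using hyb)]
      simp_rw [hKb]
      rw [lintegral_add_right_eq_self (fun a : ℝ ↦
        ENNReal.ofReal (‖G ((a : ℂ) + (c.im + b : ℝ) * I)‖ ^ 2)) c.re]
      rw [← ofReal_integral_eq_lintegral_ofReal (h2 _ hyb) (ae_of_all _ fun a ↦ by positivity)]
      exact ENNReal.ofReal_le_ofReal (hM _ hyb)
    · rw [indicator_of_notMem hb]
      have : ∀ a : ℝ, K (a, b) = 0 := fun a ↦ by
        show (Ioo (-R) R).indicator (fun _ ↦ (1 : ℝ≥0∞)) b *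
          ENNReal.ofReal (‖G₀ (c + ((a : ℂ) + b * I))‖ ^ 2) = 0
        rw [indicator_of_notMem hb, zero_mul]
      simp_rw [this]
      rw [lintegral_zero]
  calc ∫⁻ b : ℝ, ∫⁻ a : ℝ, K (a, b)
      ≤ ∫⁻ b : ℝ, (Ioo (-R) R).indicator (fun _ ↦ ENNReal.ofReal (M ^ 2)) b := lintegral_mono hinner
    _ = ENNReal.ofReal (M ^ 2) * volume (Ioo (-R) R) := by
        rw [lintegral_indicator measurableSet_Ioo, setLIntegral_const]
    _ = ENNReal.ofReal (2 * R * M ^ 2) := by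
        rw [Real.volume_Ioo, ← ENNReal.ofReal_mul (by positivity)]
        congr 1
        ring

/-- **Pointwise bound for `H²(ℂ₊)`** (Rudin 19.1-type lemma): if `G` is holomorphic on the open upper
half-plane with `∫_ℝ ‖G(x+iy)‖² dx ≤ M²` for every `y > 0`, then `‖G(z)‖ ≤ 2M/√(π Im z)`.
[cite: Rudin1987, Thm. 19.2 (proof, §19.1)] -/
theorem norm_le_of_hardy (hd : DifferentiableOn ℂ G {z : ℂ | 0 < z.im})
    (h2 : ∀ y : ℝ, 0 < y → Integrable (fun x : ℝ ↦ ‖G (x + y * I)‖ ^ 2))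
    (hM : ∀ y : ℝ, 0 < y → ∫ x : ℝ, ‖G (x + y * I)‖ ^ 2 ≤ M ^ 2) (hM0 : 0 ≤ M)
    {z : ℂ} (hz : 0 < z.im) :
    ‖G z‖ ≤ 2 * M / √(π * z.im) := by
  set R : ℝ := z.im / 2 with hR
  have hR0 : 0 < R := by rw [hR]; linarith
  have hRz : R < z.im := by rw [hR]; linarith
  have h := (pi_mul_sq_mul_norm_sq_le_lintegral_ball hd hR0 hRz).trans
    (lintegral_ball_le_of_hardy hd h2 hM hRz)
  rw [ENNReal.ofReal_le_ofReal_iff (by positivity)] at h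
  -- `π R² ‖G z‖² ≤ 2 R M²`, i.e. `‖G z‖² ≤ 4M²/(π Im z)`
  have hsq : ‖G z‖ ^ 2 ≤ (2 * M / √(π * z.im)) ^ 2 := by
    rw [div_pow, Real.sq_sqrt (by positivity), mul_pow]
    rw [le_div_iff₀ (by positivity)]
    have : ‖G z‖ ^ 2 * (π * z.im) = 2 * (π * R * ‖G z‖ ^ 2) := by rw [hR]; ring
    rw [this]
    nlinarith [hR0]
  have hnn : 0 ≤ 2 * M / √(π * z.im) := by positivity
  exact (pow_le_pow_iff_left₀ (norm_nonneg _) hnn two_ne_zero).1 hsq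

end Pointwise


/-! ## B. Half-line Fourier–Laplace transforms of `L²` functions: integrability and uniqueness -/

section HalfLine

/-- For `ψ ∈ L²(ℝ)` and `Im w > 0`, `x ↦ ψ(x)e^{iwx}` is integrable on `(0,∞)` (Cauchy–Schwarz against
`e^{−x Im w}`). [cite: Rudin1987, Thm. 19.2 (proof)] -/
theorem integrableOn_mul_cexp_Ioi_of_memLp {ψ : ℝ → ℂ} (hψ : MemLp ψ 2 volume) {w : ℂ}
    (hw : 0 < w.im) : IntegrableOn (fun x : ℝ ↦ ψ x * cexp (I * w * x)) (Ioi 0) := by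
  have hexp : MemLp (fun x : ℝ ↦ cexp (I * w * x)) 2 (volume.restrict (Ioi (0 : ℝ))) := by
    have hnorm : ∀ x : ℝ, ‖cexp (I * w * x)‖ = Real.exp (-w.im * x) := by
      intro x
      rw [Complex.norm_exp]
      congr 1
      simp [Complex.mul_re, Complex.mul_im, Complex.I_re, Complex.I_im]
    have hg : MemLp (fun x : ℝ ↦ Real.exp (-w.im * x)) 2 (volume.restrict (Ioi (0 : ℝ))) := by
      have hint : Integrable (fun x : ℝ ↦ Real.exp (-w.im * x) ^ 2) (volume.restrict (Ioi 0)) := by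
        have : (fun x : ℝ ↦ Real.exp (-w.im * x) ^ 2) = fun x ↦ Real.exp (-(2 * w.im) * x) := by
          funext x; rw [← Real.exp_nat_mul]; congr 1; push_cast; ring
        rw [this]
        exact exp_neg_integrableOn_Ioi 0 (by linarith)
      exact (memLp_two_iff_integrable_sq (by fun_prop)).2 hint
    refine MemLp.of_le hg (by fun_prop) (Eventually.of_forall fun x ↦ ?_)
    rw [hnorm, Real.norm_eq_abs, abs_of_pos (Real.exp_pos _)]
  exact MemLp.integrable_mul (hψ.restrict _) hexp

/-- **Uniqueness of the half-line Fourier–Laplace representation**: two `L²` functions vanishing a.e.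
on `(−∞,0)` with the same transforms `∫₀^∞ ψ(x)e^{iwx}dx` on the upper half-plane agree a.e.
(Fourier uniqueness for the integrable function `1_{(0,∞)} e^{−x}(ψ − ψ′)`).
[cite: Rudin1987, Thm. 19.2] -/
theorem ae_eq_of_halfLine_laplace_eq {ψ ψ' : ℝ → ℂ} (hψ : MemLp ψ 2 volume)
    (hψ' : MemLp ψ' 2 volume) (h0 : ∀ᵐ x : ℝ, x < 0 → ψ x = 0) (h0' : ∀ᵐ x : ℝ, x < 0 → ψ' x = 0)
    (heq : ∀ w : ℂ, 0 < w.im →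
      ∫ x in Ioi (0 : ℝ), ψ x * cexp (I * w * x) = ∫ x in Ioi (0 : ℝ), ψ' x * cexp (I * w * x)) :
    ψ =ᵐ[volume] ψ' := by
  -- the integrable function `k = 1_{(0,∞)} e^{−x} (ψ − ψ')`
  set d : ℝ → ℂ := fun x ↦ ψ x - ψ' x with hd_def
  have hd2 : MemLp d 2 volume := hψ.sub hψ'
  set k : ℝ → ℂ := fun x ↦ (Ioi (0 : ℝ)).indicator (fun x : ℝ ↦ cexp ((-1 : ℂ) * x)) x * d x
    with hk_def
  have hexp2 : MemLp ((Ioi (0 : ℝ)).indicator fun x : ℝ ↦ cexp ((-1 : ℂ) * x)) 2 volume := by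
    have hmeas : AEStronglyMeasurable ((Ioi (0 : ℝ)).indicator fun x : ℝ ↦ cexp ((-1 : ℂ) * x))
        volume :=
      (by fun_prop : Continuous fun x : ℝ ↦ cexp ((-1 : ℂ) * x)).aestronglyMeasurable.indicator
        measurableSet_Ioi
    refine (memLp_two_iff_integrable_sq_norm hmeas).2 ?_
    have hi : IntegrableOn (fun x : ℝ ↦ Real.exp (-(2 : ℝ) * x)) (Ioi 0) :=
      exp_neg_integrableOn_Ioi 0 (by norm_num)
    refine (hi.integrable_indicator measurableSet_Ioi).congr (Eventually.of_forall fun x ↦ ?_)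
    by_cases hx : x ∈ Ioi (0 : ℝ)
    · simp only [indicator_of_mem hx, Complex.norm_exp]
      rw [← Real.exp_nat_mul]
      congr 1
      simp
    · simp [indicator_of_notMem hx]
  have hk : Integrable k := hexp2.integrable_mul hd2
  -- its Fourier transform vanishes
  have hFk : ∀ ξ : ℝ, 𝓕 k ξ = 0 := by
    intro ξ
    set w : ℂ := ((-(2 * π) * ξ : ℝ) : ℂ) + I with hw_def
    have hw : 0 < w.im := by simp [hw_def]
    have e1 : 𝓕 k ξ = ∫ x in Ioi (0 : ℝ), d x * cexp (I * w * x) := by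
      rw [Real.fourier_real_eq_integral_exp_smul, ← integral_indicator measurableSet_Ioi]
      refine integral_congr_ae (Eventually.of_forall fun x ↦ ?_)
      simp only [hk_def, smul_eq_mul]
      by_cases hx : x ∈ Ioi (0 : ℝ)
      · rw [indicator_of_mem hx, indicator_of_mem hx, ← mul_assoc, ← Complex.exp_add,
          mul_comm (d x)]
        congr 2
        rw [hw_def]
        push_cast
        ring_nf
        linear_combination (-(x : ℂ)) * Complex.I_sq
      · rw [indicator_of_notMem hx, indicator_of_notMem hx, zero_mul, mul_zero]
    have e2 : ∫ x in Ioi (0 : ℝ), d x * cexp (I * w * x) =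
        (∫ x in Ioi (0 : ℝ), ψ x * cexp (I * w * x)) -
          ∫ x in Ioi (0 : ℝ), ψ' x * cexp (I * w * x) := by
      rw [← integral_sub (integrableOn_mul_cexp_Ioi_of_memLp hψ hw)
        (integrableOn_mul_cexp_Ioi_of_memLp hψ' hw)]
      refine integral_congr_ae (Eventually.of_forall fun x ↦ ?_)
      simp only [hd_def]
      ring
    rw [e1, e2, heq w hw, sub_self]
  have hk0 := Literature.Analysis.Fourier.ae_eq_zero_of_forall_fourier_eq_zero hk hFk
  -- conclude
  have hpt : ∀ᵐ x : ℝ, x ≠ 0 := compl_mem_ae_iff.2 (measure_singleton (0 : ℝ))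
  filter_upwards [hk0, h0, h0', hpt] with x hx h1 h2 h3
  rcases lt_or_gt_of_ne h3 with hneg | hpos
  · rw [h1 hneg, h2 hneg]
  · have hx' : (Ioi (0 : ℝ)).indicator (fun x : ℝ ↦ cexp ((-1 : ℂ) * x)) x * d x = 0 := hx
    rw [indicator_of_mem (show x ∈ Ioi (0 : ℝ) from hpos)] at hx'
    have := (mul_eq_zero.1 hx').resolve_left (Complex.exp_ne_zero _)
    exact sub_eq_zero.1 this

/-- `‖F‖² = ∫ ‖F(ξ)‖² dξ` for a class `F ∈ L²(ℝ)` (private copy of the cell's lemma). [folklore] -/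
private theorem norm_sq_eq_integral_norm_sq' (F : Lp ℂ 2 (volume : Measure ℝ)) :
    ‖F‖ ^ 2 = ∫ ξ : ℝ, ‖(F : ℝ → ℂ) ξ‖ ^ 2 := by
  have h1 : inner ℂ F F = ((‖F‖ ^ 2 : ℝ) : ℂ) := by
    rw [inner_self_eq_norm_sq_to_K]; norm_cast
  have h2 : inner ℂ F F = ((∫ ξ : ℝ, ‖(F : ℝ → ℂ) ξ‖ ^ 2 : ℝ) : ℂ) := by
    rw [L2.inner_def, ← integral_complex_ofReal]
    refine integral_congr_ae (ae_of_all _ fun ξ ↦ ?_)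
    beta_reduce
    rw [inner_self_eq_norm_sq_to_K]
    norm_cast
  exact_mod_cast Complex.ofReal_injective (h1.symm.trans h2)

end HalfLine

/-! ## C. Paley–Wiener for `H²(ℂ₊)` -/

section PaleyWiener

variable {G : ℂ → ℂ} {M : ℝ}

/-- The vertical translate `z ↦ G(z + iε)` of an `H²` function satisfies the hypotheses of the
boundary-regular Paley–Wiener theorem: differentiable on the closed upper half-plane, `L²` on `ℝ`,
and `‖G(z + iε)‖ ≤ (2M/√π)/√(Im z)`. [cite: Rudin1987, Thm. 19.2 (proof)] -/
theorem translate_hypotheses_of_hardy (hd : DifferentiableOn ℂ G {z : ℂ | 0 < z.im})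
    (h2 : ∀ y : ℝ, 0 < y → Integrable (fun x : ℝ ↦ ‖G (x + y * I)‖ ^ 2))
    (hM : ∀ y : ℝ, 0 < y → ∫ x : ℝ, ‖G (x + y * I)‖ ^ 2 ≤ M ^ 2) (hM0 : 0 ≤ M)
    {ε : ℝ} (hε : 0 < ε) :
    (∀ z : ℂ, 0 ≤ z.im → DifferentiableAt ℂ (fun z ↦ G (z + ε * I)) z) ∧
      (Integrable fun x : ℝ ↦ ‖(fun z ↦ G (z + ε * I)) x‖ ^ 2) ∧
      ∀ z : ℂ, 0 < z.im → (0 : ℝ) ≤ ‖z‖ →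
        ‖(fun z ↦ G (z + ε * I)) z‖ ≤ (2 * M / √π) / √z.im := by
  have hopen : IsOpen {z : ℂ | 0 < z.im} := isOpen_lt continuous_const Complex.continuous_im
  refine ⟨fun z hz ↦ ?_, h2 ε hε, fun z hz _ ↦ ?_⟩
  · have hmem : z + ε * I ∈ {z : ℂ | 0 < z.im} := by
      show 0 < (z + ε * I).im
      simpa using by linarith
    exact (hd.differentiableAt (hopen.mem_nhds hmem)).comp z (differentiableAt_id.add_const _)
  · have him : 0 < (z + ε * I).im := by simpa using by linarith
    have h := norm_le_of_hardy hd h2 hM hM0 him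
    simp only
    refine h.trans ?_
    have him' : (z + ε * I).im = z.im + ε := by simp
    rw [him', div_div, Real.sqrt_mul Real.pi_pos.le]
    have hsz : 0 < √z.im := Real.sqrt_pos.2 hz
    gcongr
    linarith

/-- **Paley–Wiener for `H²` of the upper half-plane** (general form): a function `G` holomorphic on
`{Im z > 0}` with `∫_ℝ ‖G(x+iy)‖² dx ≤ M²` for all `y > 0` is the Fourier–Laplace transform
`G(w) = ∫₀^∞ ψ(x) e^{iwx} dx` (all `w` with `Im w > 0`) of a function `ψ ∈ L²(ℝ)` vanishing a.e. on
`(−∞,0)`, with `2π ∫‖ψ‖² ≤ M²`; `ψ` is unique a.e. (`ae_eq_of_halfLine_laplace_eq`).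
[cite: Rudin1987, Thm. 19.2] -/
theorem exists_halfLine_laplace_of_hardy (hd : DifferentiableOn ℂ G {z : ℂ | 0 < z.im})
    (h2 : ∀ y : ℝ, 0 < y → Integrable (fun x : ℝ ↦ ‖G (x + y * I)‖ ^ 2))
    (hM : ∀ y : ℝ, 0 < y → ∫ x : ℝ, ‖G (x + y * I)‖ ^ 2 ≤ M ^ 2) (hM0 : 0 ≤ M) :
    ∃ ψ : ℝ → ℂ, MemLp ψ 2 volume ∧ (∀ᵐ x : ℝ, x < 0 → ψ x = 0) ∧
      2 * π * ∫ x : ℝ, ‖ψ x‖ ^ 2 ≤ M ^ 2 ∧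
      ∀ w : ℂ, 0 < w.im → ∫ x in Ioi (0 : ℝ), ψ x * cexp (I * w * x) = G w := by
  -- Step 1: the translates and their representing functions `ψ_ε`
  have hC : 0 ≤ 2 * M / √π := by positivity
  have hT := fun ε (hε : 0 < ε) ↦ translate_hypotheses_of_hardy hd h2 hM hM0 hε
  have hGε : ∀ ε : ℝ, 0 < ε →
      MemLp (fun ξ : ℝ ↦ (fun z ↦ G (z + ε * I)) ((-(2 * π) * ξ : ℝ) : ℂ)) 2 volume :=
    fun ε hε ↦ memLp_two_boundary_dilate (hT ε hε).1 (hT ε hε).2.1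
  -- `ψ_ε` as honest functions
  set ψf : ℝ → ℝ → ℂ := fun ε ↦ if hε : 0 < ε then
      (((𝓕⁻ ((hGε ε hε).toLp _ : Lp ℂ 2 (volume : Measure ℝ)) : Lp ℂ 2 (volume : Measure ℝ)))
        : ℝ → ℂ)
    else 0 with hψf
  have hψf_mem : ∀ ε : ℝ, 0 < ε → MemLp (ψf ε) 2 volume := by
    intro ε hε; rw [hψf]; simp only [dif_pos hε]; exact Lp.memLp _
  have hψf_zero : ∀ ε : ℝ, 0 < ε → ∀ᵐ x : ℝ, x < 0 → ψf ε x = 0 := by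
    intro ε hε
    rw [hψf]; simp only [dif_pos hε]
    exact fourierInv_ae_eq_zero_of_neg hC (hT ε hε).1 (hT ε hε).2.1 (hT ε hε).2.2 (hGε ε hε)
  have hψf_lap : ∀ ε : ℝ, 0 < ε → ∀ w : ℂ, 0 < w.im →
      ∫ x in Ioi (0 : ℝ), ψf ε x * cexp (I * w * x) = G (w + ε * I) := by
    intro ε hε w hw
    rw [hψf]; simp only [dif_pos hε]
    exact integral_Ioi_fourierInv_mul_cexp_eq hC (hT ε hε).1 (hT ε hε).2.1 (hT ε hε).2.2
      (hGε ε hε) hw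
  have hψf_norm : ∀ ε : ℝ, 0 < ε → 2 * π * ∫ x : ℝ, ‖ψf ε x‖ ^ 2 ≤ M ^ 2 := by
    intro ε hε
    set F : Lp ℂ 2 (volume : Measure ℝ) := (hGε ε hε).toLp _ with hF
    have hψ_eq : ∫ x : ℝ, ‖ψf ε x‖ ^ 2 =
        ‖(𝓕⁻ F : Lp ℂ 2 (volume : Measure ℝ))‖ ^ 2 := by
      rw [norm_sq_eq_integral_norm_sq', hψf]
      simp only [dif_pos hε]
      rfl
    have h1 : ‖(𝓕⁻ F : Lp ℂ 2 (volume : Measure ℝ))‖ = ‖F‖ := by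
      rw [← Lp.norm_fourier_eq (𝓕⁻ F : Lp ℂ 2 (volume : Measure ℝ)), fourier_fourierInv_eq]
    have h2' : ‖F‖ ^ 2 = ∫ ξ : ℝ, ‖G (((-(2 * π) * ξ : ℝ) : ℂ) + ε * I)‖ ^ 2 := by
      rw [norm_sq_eq_integral_norm_sq']
      refine integral_congr_ae ?_
      filter_upwards [(hGε ε hε).coeFn_toLp] with ξ hξ
      rw [hξ]
    have h3 : ∫ ξ : ℝ, ‖G (((-(2 * π) * ξ : ℝ) : ℂ) + ε * I)‖ ^ 2 =
        (2 * π)⁻¹ * ∫ u : ℝ, ‖G (u + ε * I)‖ ^ 2 := by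
      rw [Measure.integral_comp_mul_left (fun u : ℝ ↦ ‖G (u + ε * I)‖ ^ 2) (-(2 * π)),
        smul_eq_mul, abs_inv, abs_neg, abs_of_pos Real.two_pi_pos]
    rw [hψ_eq, h1, h2', h3, ← mul_assoc, mul_inv_cancel₀ Real.two_pi_pos.ne', one_mul]
    exact hM ε hε
  -- Step 2: `ψ_ε = e^{−(ε−ε')x} ψ_{ε'}` for `ε' ≤ ε`
  have hrel : ∀ ε ε' : ℝ, 0 < ε' → ε' ≤ ε →
      ψf ε =ᵐ[volume] fun x ↦ cexp (-(((ε - ε' : ℝ)) : ℂ) * x) * ψf ε' x := by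
    intro ε ε' hε' hle
    have hε : 0 < ε := hε'.trans_le hle
    -- the candidate is in `L²` and vanishes on the negatives
    have hbd : ∀ᵐ x : ℝ, ‖cexp (-(((ε - ε' : ℝ)) : ℂ) * x) * ψf ε' x‖ ≤ ‖ψf ε' x‖ := by
      filter_upwards [hψf_zero ε' hε'] with x hx
      rcases lt_or_ge x 0 with hneg | hnn
      · rw [hx hneg, mul_zero]
      · rw [norm_mul, Complex.norm_exp]
        have : (-(((ε - ε' : ℝ)) : ℂ) * x).re = -((ε - ε') * x) := by
          simp [Complex.mul_re]
          ring
        rw [this]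
        have hle1 : Real.exp (-((ε - ε') * x)) ≤ 1 := by
          rw [Real.exp_le_one_iff]
          nlinarith
        exact mul_le_of_le_one_left (norm_nonneg _) hle1
    have hmem' : MemLp (fun x : ℝ ↦ cexp (-(((ε - ε' : ℝ)) : ℂ) * x) * ψf ε' x) 2 volume :=
      MemLp.of_le (hψf_mem ε' hε')
        ((by fun_prop : Continuous fun x : ℝ ↦ cexp (-(((ε - ε' : ℝ)) : ℂ) * x))
          |>.aestronglyMeasurable.mul (hψf_mem ε' hε').1) hbd
    refine ae_eq_of_halfLine_laplace_eq (hψf_mem ε hε) hmem' (hψf_zero ε hε) ?_ ?_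
    · filter_upwards [hψf_zero ε' hε'] with x hx hneg
      rw [hx hneg, mul_zero]
    · intro w hw
      have hw' : 0 < (w + ((ε - ε' : ℝ) : ℂ) * I).im := by simpa using by linarith
      rw [hψf_lap ε hε w hw]
      have e : ∫ x in Ioi (0 : ℝ), cexp (-(((ε - ε' : ℝ)) : ℂ) * x) * ψf ε' x * cexp (I * w * x) =
          ∫ x in Ioi (0 : ℝ), ψf ε' x * cexp (I * (w + ((ε - ε' : ℝ) : ℂ) * I) * x) := by
        refine integral_congr_ae (Eventually.of_forall fun x ↦ ?_)
        calc cexp (-(((ε - ε' : ℝ)) : ℂ) * x) * ψf ε' x * cexp (I * w * x)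
            = cexp (-(((ε - ε' : ℝ)) : ℂ) * x) * cexp (I * w * x) * ψf ε' x := by ring
          _ = cexp (I * (w + ((ε - ε' : ℝ) : ℂ) * I) * x) * ψf ε' x := by
              rw [← Complex.exp_add]
              congr 2
              linear_combination (-(((ε - ε' : ℝ)) : ℂ) * x) * Complex.I_sq
          _ = ψf ε' x * cexp (I * (w + ((ε - ε' : ℝ) : ℂ) * I) * x) := mul_comm _ _
      rw [e, hψf_lap ε' hε' _ hw']
      congr 1
      push_cast
      ring
  -- Step 3: the function `ψ = e^{x} ψ_1`
  set ψ : ℝ → ℂ := fun x ↦ cexp (x : ℂ) * ψf 1 x with hψ_def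
  have hψε : ∀ ε : ℝ, 0 < ε → ψf ε =ᵐ[volume] fun x ↦ cexp (-(ε : ℂ) * x) * ψ x := by
    intro ε hε
    rcases le_total ε 1 with hle | hge
    · -- `ψ_1 = e^{−(1−ε)x} ψ_ε`
      filter_upwards [hrel 1 ε hε hle] with x hx
      rw [hψ_def]
      simp only
      rw [hx, ← mul_assoc, ← mul_assoc, ← Complex.exp_add, ← Complex.exp_add]
      have : -(ε : ℂ) * x + x + -(((1 - ε : ℝ)) : ℂ) * x = 0 := by push_cast; ring
      rw [this, Complex.exp_zero, one_mul]
    · filter_upwards [hrel ε 1 one_pos hge] with x hx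
      rw [hx, hψ_def]
      simp only
      rw [← mul_assoc, ← Complex.exp_add]
      congr 1
      push_cast
      ring_nf
  -- Step 4: `ψ ∈ L²` with `2π ∫‖ψ‖² ≤ M²` by monotone convergence
  have hψ_meas : AEStronglyMeasurable ψ volume :=
    (by fun_prop : Continuous fun x : ℝ ↦ cexp (x : ℂ)).aestronglyMeasurable.mul (hψf_mem 1 one_pos).1
  have hψ_zero : ∀ᵐ x : ℝ, x < 0 → ψ x = 0 := by
    filter_upwards [hψf_zero 1 one_pos] with x hx hneg
    rw [hψ_def]; simp only; rw [hx hneg, mul_zero]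
  -- the lintegral of `‖ψ‖²` as a supremum
  have hlint_eps : ∀ n : ℕ, ∫⁻ x : ℝ, ENNReal.ofReal (Real.exp (-(2 / (n + 1 : ℝ)) * x) * ‖ψ x‖ ^ 2)
      ≤ ENNReal.ofReal (M ^ 2 / (2 * π)) := by
    intro n
    set ε : ℝ := 1 / (n + 1 : ℝ) with hε_def
    have hε : 0 < ε := by rw [hε_def]; positivity
    have heq : (fun x : ℝ ↦ ENNReal.ofReal (Real.exp (-(2 / (n + 1 : ℝ)) * x) * ‖ψ x‖ ^ 2))
        =ᵐ[volume] fun x ↦ ENNReal.ofReal (‖ψf ε x‖ ^ 2) := by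
      filter_upwards [hψε ε hε] with x hx
      have hre : (-(ε : ℂ) * x).re = -(ε * x) := by simp [Complex.mul_re]
      have hR : ‖cexp (-(ε : ℂ) * x) * ψ x‖ ^ 2 = Real.exp (-(2 / (n + 1 : ℝ)) * x) * ‖ψ x‖ ^ 2 := by
        rw [norm_mul, mul_pow, Complex.norm_exp, hre, ← Real.exp_nat_mul]
        congr 2
        rw [hε_def]; push_cast; ring
      rw [hx, hR]
    rw [lintegral_congr_ae heq, ← ofReal_integral_eq_lintegral_ofReal
      ((memLp_two_iff_integrable_sq_norm (hψf_mem ε hε).1).1 (hψf_mem ε hε))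
      (ae_of_all _ fun x ↦ by positivity)]
    refine ENNReal.ofReal_le_ofReal ?_
    rw [le_div_iff₀ Real.two_pi_pos, mul_comm]
    exact hψf_norm ε hε
  have hlint : ∫⁻ x : ℝ, ENNReal.ofReal (‖ψ x‖ ^ 2) ≤ ENNReal.ofReal (M ^ 2 / (2 * π)) := by
    set f : ℕ → ℝ → ℝ≥0∞ := fun n x ↦
      ENNReal.ofReal (Real.exp (-(2 / (n + 1 : ℝ)) * x) * ‖ψ x‖ ^ 2) with hf_def
    have hf_meas : ∀ n, AEMeasurable (f n) volume := by
      intro n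
      refine ENNReal.measurable_ofReal.comp_aemeasurable ?_
      exact ((by fun_prop : Continuous fun x : ℝ ↦ Real.exp (-(2 / (n + 1 : ℝ)) * x)).aemeasurable.mul
        ((hψ_meas.norm.aemeasurable).pow_const 2))
    have hf_mono : ∀ᵐ x : ℝ, Monotone fun n ↦ f n x := by
      filter_upwards [hψ_zero] with x hx
      rcases lt_or_ge x 0 with hneg | hnn
      · intro m n _
        simp [hf_def, hx hneg]
      · intro m n hmn
        simp only [hf_def]
        refine ENNReal.ofReal_le_ofReal (mul_le_mul_of_nonneg_right ?_ (by positivity))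
        refine Real.exp_le_exp.2 (mul_le_mul_of_nonneg_right ?_ hnn)
        have hm : (0 : ℝ) < m + 1 := by positivity
        have hmn' : (m : ℝ) + 1 ≤ n + 1 := by exact_mod_cast Nat.succ_le_succ hmn
        rw [neg_le_neg_iff]
        exact div_le_div_of_nonneg_left (by norm_num) hm hmn'
    have hf_lim : ∀ᵐ x : ℝ, ENNReal.ofReal (‖ψ x‖ ^ 2) ≤ ⨆ n, f n x := by
      filter_upwards with x
      have ht : Tendsto (fun n ↦ f n x) atTop (𝓝 (ENNReal.ofReal (‖ψ x‖ ^ 2))) := by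
        have h1 : Tendsto (fun n : ℕ ↦ -(2 / (n + 1 : ℝ)) * x) atTop (𝓝 (-(2 * 0) * x)) := by
          have := (tendsto_one_div_add_atTop_nhds_zero_nat.const_mul 2).neg.mul_const x
          refine this.congr fun n ↦ ?_
          ring
        rw [mul_zero, neg_zero, zero_mul] at h1
        have h2 : Tendsto (fun n : ℕ ↦ Real.exp (-(2 / (n + 1 : ℝ)) * x) * ‖ψ x‖ ^ 2) atTop
            (𝓝 (Real.exp 0 * ‖ψ x‖ ^ 2)) :=
          ((Real.continuous_exp.tendsto _).comp h1).mul_const _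
        rw [Real.exp_zero, one_mul] at h2
        exact (ENNReal.continuous_ofReal.tendsto _).comp h2
      exact le_of_tendsto' ht fun n ↦ le_iSup (fun n ↦ f n x) n
    calc ∫⁻ x : ℝ, ENNReal.ofReal (‖ψ x‖ ^ 2) ≤ ∫⁻ x : ℝ, ⨆ n, f n x := lintegral_mono_ae hf_lim
      _ = ⨆ n, ∫⁻ x : ℝ, f n x := lintegral_iSup' hf_meas hf_mono
      _ ≤ ENNReal.ofReal (M ^ 2 / (2 * π)) := iSup_le hlint_eps
  -- Step 5: conclusion
  have hψ_sq_int : Integrable (fun x : ℝ ↦ ‖ψ x‖ ^ 2) := by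
    refine ⟨(hψ_meas.norm.aemeasurable.pow_const 2).aestronglyMeasurable, ?_⟩
    rw [hasFiniteIntegral_iff_ofReal (ae_of_all _ fun x ↦ by positivity)]
    exact hlint.trans_lt ENNReal.ofReal_lt_top
  have hψ_mem : MemLp ψ 2 volume := (memLp_two_iff_integrable_sq_norm hψ_meas).2 hψ_sq_int
  refine ⟨ψ, hψ_mem, hψ_zero, ?_, fun w hw ↦ ?_⟩
  · have h1 : ∫ x : ℝ, ‖ψ x‖ ^ 2 ≤ M ^ 2 / (2 * π) := by
      rw [integral_eq_lintegral_of_nonneg_ae (ae_of_all _ fun x ↦ by positivity)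
        hψ_sq_int.aestronglyMeasurable]
      have := ENNReal.toReal_mono ENNReal.ofReal_ne_top hlint
      rwa [ENNReal.toReal_ofReal (by positivity)] at this
    rw [le_div_iff₀ Real.two_pi_pos] at h1
    linarith
  · set ε : ℝ := w.im / 2 with hε_def
    have hε : 0 < ε := by rw [hε_def]; linarith
    have hw' : 0 < (w - ε * I).im := by simp [hε_def]; linarith
    have h := hψf_lap ε hε (w - ε * I) hw'
    rw [sub_add_cancel] at h
    rw [← h]
    refine integral_congr_ae ?_
    filter_upwards [ae_restrict_of_ae (hψε ε hε)] with x hx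
    rw [hx]
    calc ψ x * cexp (I * w * x)
        = (cexp (-(ε : ℂ) * x) * cexp (I * (w - ε * I) * x)) * ψ x := by
          rw [← Complex.exp_add, mul_comm]
          congr 2
          linear_combination (ε : ℂ) * x * Complex.I_sq
      _ = cexp (-(ε : ℂ) * x) * ψ x * cexp (I * (w - ε * I) * x) := by ring

end PaleyWiener

end Literature.Analysis.DeBrangesSpaces
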